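import Mathlib.MeasureTheory.Integral.IntervalIntegral.FundThmCalculus
import Mathlib.Analysis.SpecialFunctions.Sqrt
import Mathlib.Analysis.InnerProductSpace.Calculus
import Summits.AtomisticToContinuum.Crystallization.Theorems.OverbindingBudgetAffineNearCluster

/-!
# OverbindingBudget — BT · `BondTaylorExpansion` PROVED, and cone LIII at the record literals with the BT slot dropped

decomp-a2c prover hand-1 (generation 18), critic rows 670 / 672: the (S)-piece `BondTaylorExpansion` of lens-4 g44's node
`…Theorems.OverbindingBudgetAffineNearCluster` («NearFloorOrders», 31280 slot 3 near regime) is a calculus fact —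
`V(‖b + v‖) = V(‖b‖) + V′(‖b‖)·⟪b, v⟫/‖b‖ + ∫₀¹ (1 − t)·ljBondHess (b + t v) v dt` for `‖v‖ < ‖b‖` — proved here from Mathlib's FTC-2
(`intervalIntegral.integral_eq_sub_of_hasDerivAt`) applied to `h(t) = V(‖b + t v‖) + (1 − t)·(d/dt) V(‖b + t v‖)`, whose derivative is
`(1 − t)·ljBondHess (b + t v) v` (the tree's `ljD1`/`ljD2`/`ljBondHess` bookkeeping checked symbolically: `V′ = −r⁻¹³ + r⁻⁷`,
`(V′/r)′ = 14 r⁻¹⁵ − 8 r⁻⁹`, `V″ = 13 r⁻¹⁴ − 7 r⁻⁸`).  Consequence: `tbdsg_of_nearOrders_bt` / `tbdsg_of_nearOrders_record_bt` = cone LIII without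
the BT slot.  No definitions, no `sorry`, standard axioms.  `--supports stmt-AtomisticToContinuum-31280`.
-/

noncomputable section

namespace Summit.AtomisticToContinuum.Crystallization.Theorems.OverbindingBudgetAffineNearCluster

open MeasureTheory Set intervalIntegral
open Literature.MathematicalPhysics.StatisticalMechanics (lennardJones)
open Summit.AtomisticToContinuum.Crystallization.Theorems.OverbindingBudgetHarmonicNormalForm
  (ljD1 ljD2 ljBondHess bondStretchSq)
open Summit.AtomisticToContinuum.Crystallization.Theorems.OverbindingBudgetBalancedCensusStatements
  (TameBalancedDeepScaleGap)
open Summit.AtomisticToContinuum.Crystallization.Theorems.OverbindingBudgetAffineLadder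
open Summit.AtomisticToContinuum.Crystallization.Theorems.OverbindingBudgetAffineLocalisation

/-! ## §1  One-variable calculus of `r ↦ (r⁻¹)^n`, `V`, `V′/r` -/

/-- `d/dr (r⁻¹)^n = −n · (r⁻¹)^(n+1)` at `r ≠ 0`. [calculus] -/
theorem hasDerivAt_inv_pow (n : ℕ) {r : ℝ} (hr : r ≠ 0) :
    HasDerivAt (fun s : ℝ => (s⁻¹) ^ n) (-(n : ℝ) * (r⁻¹) ^ (n + 1)) r := by
  cases n with
  | zero =>
    simp only [pow_zero, Nat.cast_zero, neg_zero, zero_mul]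
    exact hasDerivAt_const r 1
  | succ k =>
    have h := (hasDerivAt_inv hr).pow (k + 1)
    simp only [Nat.add_sub_cancel] at h
    refine h.congr_deriv ?_
    simp only [inv_pow]
    push_cast
    field_simp
    ring

/-- `V′ = ljD1`: `d/dr lennardJones r = ljD1 r` at `r ≠ 0`. [calculus] -/
theorem hasDerivAt_lennardJones {r : ℝ} (hr : r ≠ 0) :
    HasDerivAt lennardJones (ljD1 r) r := by
  have h : HasDerivAt (fun s : ℝ => 1 / 12 * (s⁻¹) ^ 12 - 1 / 6 * (s⁻¹) ^ 6)
      (1 / 12 * (-(12 : ℕ) * (r⁻¹) ^ (12 + 1)) - 1 / 6 * (-(6 : ℕ) * (r⁻¹) ^ (6 + 1))) r :=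
    ((hasDerivAt_inv_pow 12 hr).const_mul (1 / 12)).sub ((hasDerivAt_inv_pow 6 hr).const_mul (1 / 6))
  refine h.congr_deriv ?_
  unfold ljD1
  push_cast
  ring

/-- `φ(r) := V′(r)/r = −(r⁻¹)^14 + (r⁻¹)^8` has derivative `14 (r⁻¹)^15 − 8 (r⁻¹)^9` at `r ≠ 0`. [calculus] -/
theorem hasDerivAt_ljD1_div {r : ℝ} (hr : r ≠ 0) :
    HasDerivAt (fun s : ℝ => ljD1 s / s) (14 * (r⁻¹) ^ 15 - 8 * (r⁻¹) ^ 9) r := by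
  have h : HasDerivAt (fun s : ℝ => -(s⁻¹) ^ 14 + (s⁻¹) ^ 8)
      (-(-(14 : ℕ) * (r⁻¹) ^ (14 + 1)) + -(8 : ℕ) * (r⁻¹) ^ (8 + 1)) r :=
    ((hasDerivAt_inv_pow 14 hr).neg).add (hasDerivAt_inv_pow 8 hr)
  have e : (fun s : ℝ => -(s⁻¹) ^ 14 + (s⁻¹) ^ 8) = fun s : ℝ => ljD1 s / s := by
    funext s
    unfold ljD1
    by_cases hs : s = 0
    · subst hs; simp
    · field_simp
  rw [e] at h
  refine h.congr_deriv ?_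
  push_cast
  ring

/-! ## §2  The bond length along the segment `t ↦ b + t • v` -/

variable {b v : EuclideanSpace ℝ (Fin 3)}

/-- The segment `t ↦ b + t•v` has velocity `v`. -/
theorem hasDerivAt_seg (b v : EuclideanSpace ℝ (Fin 3)) (t : ℝ) : HasDerivAt (fun s : ℝ => b + s • v) v t := by
  have h := ((hasDerivAt_id t).smul_const v).const_add b
  simpa using h

/-- Lower bound `‖b‖ − t‖v‖ ≤ ‖b + t v‖` for `0 ≤ t`. -/
theorem norm_seg_ge (b v : EuclideanSpace ℝ (Fin 3)) {t : ℝ} (ht : 0 ≤ t) : ‖b‖ - t * ‖v‖ ≤ ‖b + t • v‖ := by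
  have h1 : ‖b‖ ≤ ‖b + t • v‖ + ‖t • v‖ :=
    calc ‖b‖ = ‖(b + t • v) - t • v‖ := by rw [add_sub_cancel_right]
      _ ≤ ‖b + t • v‖ + ‖t • v‖ := norm_sub_le _ _
  rw [norm_smul, Real.norm_eq_abs, abs_of_nonneg ht] at h1
  linarith

/-- On `[0,1]` the bond stays away from `0` when `‖v‖ < ‖b‖`. -/
theorem norm_seg_pos (hvb : ‖v‖ < ‖b‖) {t : ℝ} (ht0 : 0 ≤ t) (ht1 : t ≤ 1) : 0 < ‖b + t • v‖ := by
  have h := norm_seg_ge b v ht0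
  have : t * ‖v‖ ≤ ‖v‖ := by nlinarith [norm_nonneg v]
  linarith

/-- Derivative of the bond length: `d/dt ‖b + t v‖ = ⟪b + t v, v⟫/‖b + t v‖` where the bond is nonzero. [calculus] -/
theorem hasDerivAt_norm_seg {t : ℝ} (ht : ‖b + t • v‖ ≠ 0) :
    HasDerivAt (fun s : ℝ => ‖b + s • v‖) (inner ℝ (b + t • v) v / ‖b + t • v‖) t := by
  have h1 : HasDerivAt (fun s : ℝ => ‖b + s • v‖ ^ 2) (2 * inner ℝ (b + t • v) v) t :=
    (hasDerivAt_seg b v t).norm_sq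
  have h2 := h1.sqrt (by positivity)
  have e : (fun s : ℝ => Real.sqrt (‖b + s • v‖ ^ 2)) = fun s : ℝ => ‖b + s • v‖ := by
    funext s; exact Real.sqrt_sq (norm_nonneg _)
  rw [e, Real.sqrt_sq (norm_nonneg _)] at h2
  refine h2.congr_deriv ?_
  rw [mul_div_mul_left _ _ (two_ne_zero)]

/-! ## §3  First and second derivative of `g(t) = V(‖b + t v‖)` -/

/-- `g′(t) = V′(‖d‖)·⟪d, v⟫/‖d‖` (chain rule), `d = b + t v ≠ 0`. [calculus] -/
theorem hasDerivAt_g {t : ℝ} (ht : ‖b + t • v‖ ≠ 0) :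
    HasDerivAt (fun s : ℝ => lennardJones ‖b + s • v‖)
      (ljD1 ‖b + t • v‖ / ‖b + t • v‖ * inner ℝ (b + t • v) v) t := by
  have h0 := (hasDerivAt_lennardJones ht).comp t (hasDerivAt_norm_seg ht)
  have h : HasDerivAt (fun s : ℝ => lennardJones ‖b + s • v‖)
      (ljD1 ‖b + t • v‖ * (inner ℝ (b + t • v) v / ‖b + t • v‖)) t := h0
  exact h.congr_deriv (by ring)

/-- `g″(t) = ljBondHess (b + t v) v`: product/chain rule on `g′ = (V′/r)(‖d‖)·⟪d, v⟫` with `⟪d, v⟫′ = ‖v‖²`, and the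
symbolic identity `(V′/r)′(r)·⟪d,v⟫²/r + (V′/r)(r)·‖v‖² = V″(r)·(⟪d,v⟫/r)² + (V′(r)/r)·(‖v‖² − (⟪d,v⟫/r)²)`. [calculus] -/
theorem hasDerivAt_g1 {t : ℝ} (ht : ‖b + t • v‖ ≠ 0) :
    HasDerivAt (fun s : ℝ => ljD1 ‖b + s • v‖ / ‖b + s • v‖ * inner ℝ (b + s • v) v)
      (ljBondHess (b + t • v) v) t := by
  have hφ0 := (hasDerivAt_ljD1_div ht).comp t (hasDerivAt_norm_seg ht)
  have hφ : HasDerivAt (fun s : ℝ => ljD1 ‖b + s • v‖ / ‖b + s • v‖)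
      ((14 * (‖b + t • v‖⁻¹) ^ 15 - 8 * (‖b + t • v‖⁻¹) ^ 9) * (inner ℝ (b + t • v) v / ‖b + t • v‖)) t :=
    hφ0
  have hs : HasDerivAt (fun s : ℝ => inner ℝ (b + s • v) v) (‖v‖ ^ 2) t := by
    have h : HasDerivAt (fun s : ℝ => inner ℝ b v + s * ‖v‖ ^ 2) (‖v‖ ^ 2) t :=
      (hasDerivAt_mul_const (‖v‖ ^ 2)).const_add (inner ℝ b v)
    have e : (fun s : ℝ => inner ℝ b v + s * ‖v‖ ^ 2) = fun s : ℝ => inner ℝ (b + s • v) v := by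
      funext s; rw [inner_add_left, real_inner_smul_left, real_inner_self_eq_norm_sq]
    rwa [e] at h
  have h : HasDerivAt (fun s : ℝ => ljD1 ‖b + s • v‖ / ‖b + s • v‖ * inner ℝ (b + s • v) v)
      ((14 * (‖b + t • v‖⁻¹) ^ 15 - 8 * (‖b + t • v‖⁻¹) ^ 9) * (inner ℝ (b + t • v) v / ‖b + t • v‖)
        * inner ℝ (b + t • v) v + ljD1 ‖b + t • v‖ / ‖b + t • v‖ * ‖v‖ ^ 2) t := hφ.mul hs
  refine h.congr_deriv ?_
  unfold ljBondHess bondStretchSq ljD1 ljD2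
  field_simp
  ring

/-! ## §4  Taylor with integral remainder -/

/-- Continuity of the remainder integrand on `[0, 1]`. -/
theorem continuousOn_integrand (hvb : ‖v‖ < ‖b‖) :
    ContinuousOn (fun t : ℝ => (1 - t) * ljBondHess (b + t • v) v) (Icc 0 1) := by
  have hne : ∀ t ∈ Icc (0:ℝ) 1, ‖b + t • v‖ ≠ 0 := fun t ht => (norm_seg_pos hvb ht.1 ht.2).ne'
  unfold ljBondHess bondStretchSq ljD1 ljD2
  fun_prop (disch := assumption)

/-- **BT · `BondTaylorExpansion` PROVED** — one-variable Taylor with integral remainder for `g(t) = V(‖b + t v‖)` on `[0, 1]`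
(`‖v‖ < ‖b‖` keeps the bond nonzero): `h(t) := g(t) + (1 − t)·g′(t)` has `h′(t) = (1 − t)·g″(t) = (1 − t)·ljBondHess (b + t v) v`, and
FTC-2 gives `∫₀¹ h′ = h(1) − h(0) = g(1) − g(0) − g′(0)`. [calculus] -/
theorem bondTaylorExpansion_holds : BondTaylorExpansion := by
  intro b v hvb
  have hne : ∀ t ∈ Icc (0:ℝ) 1, ‖b + t • v‖ ≠ 0 := fun t ht => (norm_seg_pos hvb ht.1 ht.2).ne'
  -- h(t) = g(t) + (1 - t) g′(t), h′ = (1 - t) g″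
  have hderiv : ∀ t ∈ uIcc (0:ℝ) 1,
      HasDerivAt (fun s : ℝ => lennardJones ‖b + s • v‖ +
          (1 - s) * (ljD1 ‖b + s • v‖ / ‖b + s • v‖ * inner ℝ (b + s • v) v))
        ((1 - t) * ljBondHess (b + t • v) v) t := by
    intro t ht
    rw [uIcc_of_le zero_le_one] at ht
    have h1 := hasDerivAt_g (hne t ht)
    have h2 := hasDerivAt_g1 (hne t ht)
    have h3 : HasDerivAt (fun s : ℝ => 1 - s) (-1) t := by
      simpa using (hasDerivAt_id t).const_sub 1
    refine (h1.add (h3.mul h2)).congr_deriv ?_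
    ring
  have hint : IntervalIntegrable (fun t : ℝ => (1 - t) * ljBondHess (b + t • v) v) volume 0 1 :=
    ((continuousOn_integrand hvb).mono (by rw [uIcc_of_le zero_le_one])).intervalIntegrable
  have hftc := integral_eq_sub_of_hasDerivAt hderiv hint
  rw [hftc]
  simp only [one_smul, zero_smul, add_zero]
  ring


/-! ## §5  Cone LIII with the BT slot discharged -/

/-- **CONE LIII without the BT slot (PROVED):**
`0 < η → (∃ μ₁ μR > 0, K_at⁰ η μ₁ μR R) → R_aff → D → RD01(…,κ₁) → N2(…,κ₂) → δm < 1 → κ₁ + κ₂ ≤ κ → Z ρ₁ θ θ₀ κ → AffMidAll ρ₁ θ → TBDSG`.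
[this file: `bondTaylorExpansion_holds` in `tbdsg_of_nearOrders`] -/
theorem tbdsg_of_nearOrders_bt (η R Rc δm ρ₁ θ θ₀ κ₁ κ₂ κ : ℝ) (hη : 0 < η)
    (hK : ∃ μ₁ μR : ℝ, 0 < μ₁ ∧ 0 < μR ∧ PureMarginStabilityAt η μ₁ μR R) (hR : AffineChartStraightening)
    (hD : DefectPairFloor) (h01 : NearReferenceLowOrders η R Rc δm ρ₁ θ θ₀ κ₁)
    (h2 : NearSecondOrderFloor η R Rc δm ρ₁ θ θ₀ κ₂) (hδm : δm < 1) (hκ : κ₁ + κ₂ ≤ κ) (hZ : FarAggregatePricing ρ₁ θ θ₀ κ)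
    (hM : AffMidAll ρ₁ θ) : TameBalancedDeepScaleGap (122 / 125) 0 4 (3 / 50) (1 / 450) :=
  tbdsg_of_nearOrders η R Rc δm ρ₁ θ θ₀ κ₁ κ₂ κ hη hK hR hD bondTaylorExpansion_holds h01 h2 hδm hκ hZ hM

/-- **CONE LIII at the record literals without the BT slot (PROVED):** `η = 3/2000`, `R = 4`, `Rc = 6`, `δm = 1/1000`, `ρ₁ = 12`,
`θ = 1/25`, `θ₀ = 1/2000`, `κ₁ = κ₂ = 1/(2·10⁶)`, `κ = 1/10⁶`; remaining slots K_at⁰, R_aff, D, RD01, N2, Z, AffMidAll.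
[this file: `bondTaylorExpansion_holds` in `tbdsg_of_nearOrders_record`] -/
theorem tbdsg_of_nearOrders_record_bt
    (hK : ∃ μ₁ μR : ℝ, 0 < μ₁ ∧ 0 < μR ∧ PureMarginStabilityAt (3 / 2000) μ₁ μR 4) (hR : AffineChartStraightening)
    (hD : DefectPairFloor)
    (h01 : NearReferenceLowOrders (3 / 2000) 4 6 (1 / 1000) 12 (1 / 25) (1 / 2000) (1 / (2 * 10 ^ 6)))
    (h2 : NearSecondOrderFloor (3 / 2000) 4 6 (1 / 1000) 12 (1 / 25) (1 / 2000) (1 / (2 * 10 ^ 6)))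
    (hZ : FarAggregatePricing 12 (1 / 25) (1 / 2000) (1 / 10 ^ 6)) (hM : AffMidAll 12 (1 / 25)) :
    TameBalancedDeepScaleGap (122 / 125) 0 4 (3 / 50) (1 / 450) :=
  tbdsg_of_nearOrders_record hK hR hD bondTaylorExpansion_holds h01 h2 hZ hM

end Summit.AtomisticToContinuum.Crystallization.Theorems.OverbindingBudgetAffineNearCluster
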